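import Summits.CriticalPhenomena.PercolationContinuityZ3.Theorems.PercNearOneGluingNoHeavyLowerTailTformWitnessSeparatedRows
import HarnessLib

/-!
# `NoHeavyLowerTail` (stmt-CriticalPhenomena-4575) — T-form gluing of two vertices separated by the witness relay (main file)

Support file (prover `prim-hp-1`, hull-port / coupling line; `--supports stmt-CriticalPhenomena-4575`).  No
definitions, no named facts, no sorries.

Setting: `μ = prodBernoulli w` on `Fin n`, relays `A`, level `j`, `N_x = |{a ∈ A : x ↔ a}|`.  The T-form (guarded
cumulative isolation) at a vertex `x` with witness relay `c` is `μ{1 ≤ N_x ≤ j} ≤ μ{1 ≤ N_x ∧ N_c ≤ j}`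
(equivalently `μ{1 ≤ N_x ≤ j, N_c > j} ≤ μ{N_x > j, N_c ≤ j}`).  The lead's MASTER GLUING RULE (memo LEAD-GEN3 §8)
asks whether `T(H,u,c) ∧ T(H,v,c) ⇒ T(H/uv, uv, c)` for two vertices glued into one.  Here we prove it when the
witness `c` SEPARATES `u` from `v`: the vertices other than `c` are covered by pairwise disjoint, pairwise
non-adjacent sides `V l` (`l : Fin d`) with `u ∈ V i`, `v ∈ V i'`, `i ≠ i'` (inside a side, and between `c` and any
side: anything).  The glued vertex is read
through `U = C(u) ∪ C(v)`: `N_U = |{a : u ↔ a ∨ v ↔ a}|`, and the glued lightness of `c` is `N_U` if `c ∈ U`, else `N_c`.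

* `WitnessSeparated.core_heavyLight` / `core_attLight` — conditional Harris rows from the locally monotone FKG
  inequality on the two sides: for `x` on one side and a decreasing (resp. increasing) event `B` read off the other
  side, `μ(B)·μ{N_x > j, N_c ≤ j} ≤ μ(B ∩ {…})` (resp. `μ(B)·μ{1 ≤ N_x ≤ j, N_c > j} ≤ μ(B ∩ {…})`).
* `inter_notReach_heavyLight_ge`, `inter_notReach_attLight_le`, `inter_unattached_heavyLight_ge`,
  `inter_unattached_attLight_le` — the rows for `B = {c ↮ y}` and `B = {x ↮ A}`.
* `WitnessSeparated.glued_diff_ge` — `μ{c ∉ U, N_U > j, N_c ≤ j} − μ{c ∉ U, 1 ≤ N_U ≤ j, N_c > j} ≥ μ(c↮v)·s_u + μ(u↮A)·s_v`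
  with `s_x = μ{N_x > j, N_c ≤ j} − μ{1 ≤ N_x ≤ j, N_c > j}` the T-slacks.
* `WitnessSeparated.tform_glued_of_tform` — `T(H,u,c) ∧ T(H,v,c) ⇒` the T-form of the glued pair.  (Crux memo
  HULLPORT-COUPLING.md §28–§29: the general two-vertex rule has no violation in 4·10⁴ exact instances but is not implied
  by any one-hypothesis or localized form; this file is its witness-separated case, where both localizations hold.)
[cite: Nolin2008, §4.3 Lemma 13 (locally monotone FKG) — the only correlation input, via `prodBernoulli_locallyMonotone_fkg`]
-/

noncomputable section

namespace Summit.CriticalPhenomena.PercolationContinuityZ3.Theorems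

open MeasureTheory Set Literature.Probability.LatticeModels Literature.Probability.Percolation
open scoped Classical BigOperators

variable {n : ℕ}

namespace WitnessSeparated

open CutObserver CutObserver.SteinerPorts

/-! ### T-form versus slack form -/

/-- `μ{1 ≤ f ≤ j} ≤ μ{1 ≤ f, g ≤ j}` iff `μ{1 ≤ f ≤ j, g > j} ≤ μ{f > j, g ≤ j}` (the T-form and its slack form):
forward direction. [folklore] -/
theorem slack_of_tform (w : Sym2 (Fin n) → unitInterval) (f g : BondConfig (Fin n) → ℕ) (j : ℕ)
    (h : (prodBernoulli w).real {ω : BondConfig (Fin n) | 1 ≤ f ω ∧ f ω ≤ j} ≤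
      (prodBernoulli w).real {ω : BondConfig (Fin n) | 1 ≤ f ω ∧ g ω ≤ j}) :
    (prodBernoulli w).real {ω : BondConfig (Fin n) | 1 ≤ f ω ∧ f ω ≤ j ∧ j < g ω} ≤
      (prodBernoulli w).real {ω : BondConfig (Fin n) | j < f ω ∧ g ω ≤ j} := by
  set μ := prodBernoulli w with hμ
  set C : Set (BondConfig (Fin n)) := {ω | 1 ≤ f ω ∧ f ω ≤ j ∧ g ω ≤ j} with hC
  have e1 : {ω : BondConfig (Fin n) | 1 ≤ f ω ∧ f ω ≤ j} =
      {ω : BondConfig (Fin n) | 1 ≤ f ω ∧ f ω ≤ j ∧ j < g ω} ∪ C := by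
    ext ω; simp only [mem_setOf_eq, mem_union, hC]; omega
  have e2 : {ω : BondConfig (Fin n) | 1 ≤ f ω ∧ g ω ≤ j} =
      {ω : BondConfig (Fin n) | j < f ω ∧ g ω ≤ j} ∪ C := by
    ext ω; simp only [mem_setOf_eq, mem_union, hC]; omega
  have d1 : Disjoint {ω : BondConfig (Fin n) | 1 ≤ f ω ∧ f ω ≤ j ∧ j < g ω} C := by
    rw [Set.disjoint_left]; intro ω h1 h2
    simp only [mem_setOf_eq, hC] at h1 h2; omega
  have d2 : Disjoint {ω : BondConfig (Fin n) | j < f ω ∧ g ω ≤ j} C := by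
    rw [Set.disjoint_left]; intro ω h1 h2
    simp only [mem_setOf_eq, hC] at h1 h2; omega
  rw [e1, e2, measureReal_union d1 MeasurableSet.of_discrete, measureReal_union d2 MeasurableSet.of_discrete] at h
  linarith

/-- The slack form implies the T-form. [folklore] -/
theorem tform_of_slack (w : Sym2 (Fin n) → unitInterval) (f g : BondConfig (Fin n) → ℕ) (j : ℕ)
    (h : (prodBernoulli w).real {ω : BondConfig (Fin n) | 1 ≤ f ω ∧ f ω ≤ j ∧ j < g ω} ≤
      (prodBernoulli w).real {ω : BondConfig (Fin n) | j < f ω ∧ g ω ≤ j}) :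
    (prodBernoulli w).real {ω : BondConfig (Fin n) | 1 ≤ f ω ∧ f ω ≤ j} ≤
      (prodBernoulli w).real {ω : BondConfig (Fin n) | 1 ≤ f ω ∧ g ω ≤ j} := by
  set μ := prodBernoulli w with hμ
  set C : Set (BondConfig (Fin n)) := {ω | 1 ≤ f ω ∧ f ω ≤ j ∧ g ω ≤ j} with hC
  have e1 : {ω : BondConfig (Fin n) | 1 ≤ f ω ∧ f ω ≤ j} =
      {ω : BondConfig (Fin n) | 1 ≤ f ω ∧ f ω ≤ j ∧ j < g ω} ∪ C := by
    ext ω; simp only [mem_setOf_eq, mem_union, hC]; omega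
  have e2 : {ω : BondConfig (Fin n) | 1 ≤ f ω ∧ g ω ≤ j} =
      {ω : BondConfig (Fin n) | j < f ω ∧ g ω ≤ j} ∪ C := by
    ext ω; simp only [mem_setOf_eq, mem_union, hC]; omega
  have d1 : Disjoint {ω : BondConfig (Fin n) | 1 ≤ f ω ∧ f ω ≤ j ∧ j < g ω} C := by
    rw [Set.disjoint_left]; intro ω h1 h2
    simp only [mem_setOf_eq, hC] at h1 h2; omega
  have d2 : Disjoint {ω : BondConfig (Fin n) | j < f ω ∧ g ω ≤ j} C := by
    rw [Set.disjoint_left]; intro ω h1 h2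
    simp only [mem_setOf_eq, hC] at h1 h2; omega
  rw [e1, e2, measureReal_union d1 MeasurableSet.of_discrete, measureReal_union d2 MeasurableSet.of_discrete]
  linarith


/-! ### Gluing two vertices separated by the witness relay -/

section Glue

variable (w : Sym2 (Fin n) → unitInterval) (A : Finset (Fin n)) (j : ℕ) (c u v : Fin n)
  {d : ℕ} (V : Fin d → Finset (Fin n))

/-- **Glued slack ≥ weighted slacks.**  With `U = C(u) ∪ C(v)`, `N_U = |{a : u ↔ a ∨ v ↔ a}|` and the T-slacks
`s_x = μ{N_x > j, N_c ≤ j} − μ{1 ≤ N_x ≤ j, N_c > j}`: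
`μ{c ↮ v}·s_u + μ{u ↮ A}·s_v ≤ μ{c ∉ U, N_U > j, N_c ≤ j} − μ{c ∉ U, 1 ≤ N_U ≤ j, N_c > j}` when the relay `c`
separates `u ∈ V i` from `v ∈ V i'`. [cite: Nolin2008, §4.3 Lemma 13 — via the four rows] -/
theorem glued_diff_ge (hcA : c ∈ A) (hcV : ∀ l, c ∉ V l) (hdisj : ∀ l l', l ≠ l' → Disjoint (V l) (V l'))
    (hcover : ∀ x, x ≠ c → ∃ l, x ∈ V l)
    (hsep : ∀ l l', l ≠ l' → ∀ x ∈ V l, ∀ y ∈ V l', w s(x, y) = 0)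
    (i i' : Fin d) (hii' : i ≠ i') (hu : u ∈ V i) (hv : v ∈ V i') :
    (prodBernoulli w).real {ω : BondConfig (Fin n) | ω ∉ openConn c v} *
        ((prodBernoulli w).real {ω : BondConfig (Fin n) |
            j < (A.filter fun a => ω ∈ openConn u a).card ∧ (A.filter fun a => ω ∈ openConn c a).card ≤ j} -
          (prodBernoulli w).real {ω : BondConfig (Fin n) |
            1 ≤ (A.filter fun a => ω ∈ openConn u a).card ∧ (A.filter fun a => ω ∈ openConn u a).card ≤ j ∧
              j < (A.filter fun a => ω ∈ openConn c a).card}) +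
      (prodBernoulli w).real {ω : BondConfig (Fin n) | ∀ a ∈ A, ω ∉ openConn u a} *
        ((prodBernoulli w).real {ω : BondConfig (Fin n) |
            j < (A.filter fun a => ω ∈ openConn v a).card ∧ (A.filter fun a => ω ∈ openConn c a).card ≤ j} -
          (prodBernoulli w).real {ω : BondConfig (Fin n) |
            1 ≤ (A.filter fun a => ω ∈ openConn v a).card ∧ (A.filter fun a => ω ∈ openConn v a).card ≤ j ∧
              j < (A.filter fun a => ω ∈ openConn c a).card}) ≤
      (prodBernoulli w).real {ω : BondConfig (Fin n) | ω ∉ openConn c u ∧ ω ∉ openConn c v ∧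
          j < (A.filter fun a => ω ∈ openConn u a ∨ ω ∈ openConn v a).card ∧
          (A.filter fun a => ω ∈ openConn c a).card ≤ j} -
        (prodBernoulli w).real {ω : BondConfig (Fin n) | ω ∉ openConn c u ∧ ω ∉ openConn c v ∧
          1 ≤ (A.filter fun a => ω ∈ openConn u a ∨ ω ∈ openConn v a).card ∧
          (A.filter fun a => ω ∈ openConn u a ∨ ω ∈ openConn v a).card ≤ j ∧
          j < (A.filter fun a => ω ∈ openConn c a).card} := by
  set μ := prodBernoulli w with hμ
  haveI : IsProbabilityMeasure μ := by rw [hμ]; infer_instance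
  have r1 := inter_notReach_heavyLight_ge w A j c V hcV hdisj hcover hsep i i' hii' hu hv
  have r2 := inter_notReach_attLight_le w A j c V hcV hdisj hcover hsep i i' hii' hu hv
  have r3 := inter_unattached_heavyLight_ge w A j c V hcA hcV hdisj hcover hsep i i' hii' hu hv
  have r4 := inter_unattached_attLight_le w A j c V hcA hcV hdisj hcover hsep i i' hii' hu hv
  -- notation
  set Gm_u : Set (BondConfig (Fin n)) := {ω |
    j < (A.filter fun a => ω ∈ openConn u a).card ∧ (A.filter fun a => ω ∈ openConn c a).card ≤ j} with hGm_u
  set Gp_u : Set (BondConfig (Fin n)) := {ω |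
    1 ≤ (A.filter fun a => ω ∈ openConn u a).card ∧ (A.filter fun a => ω ∈ openConn u a).card ≤ j ∧
      j < (A.filter fun a => ω ∈ openConn c a).card} with hGp_u
  set Gm_v : Set (BondConfig (Fin n)) := {ω |
    j < (A.filter fun a => ω ∈ openConn v a).card ∧ (A.filter fun a => ω ∈ openConn c a).card ≤ j} with hGm_v
  set Gp_v : Set (BondConfig (Fin n)) := {ω |
    1 ≤ (A.filter fun a => ω ∈ openConn v a).card ∧ (A.filter fun a => ω ∈ openConn v a).card ≤ j ∧
      j < (A.filter fun a => ω ∈ openConn c a).card} with hGp_v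
  set Dv : Set (BondConfig (Fin n)) := {ω | ω ∉ openConn c v} with hDv
  set Zu : Set (BondConfig (Fin n)) := {ω | ∀ a ∈ A, ω ∉ openConn u a} with hZu
  set X : Set (BondConfig (Fin n)) := {ω | ω ∉ openConn c u ∧ ω ∉ openConn c v ∧
    1 ≤ (A.filter fun a => ω ∈ openConn u a ∨ ω ∈ openConn v a).card ∧
    (A.filter fun a => ω ∈ openConn u a ∨ ω ∈ openConn v a).card ≤ j ∧
    j < (A.filter fun a => ω ∈ openConn c a).card} with hX
  set Y : Set (BondConfig (Fin n)) := {ω | ω ∉ openConn c u ∧ ω ∉ openConn c v ∧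
    j < (A.filter fun a => ω ∈ openConn u a ∨ ω ∈ openConn v a).card ∧
    (A.filter fun a => ω ∈ openConn c a).card ≤ j} with hY
  -- the count of `u` is at most the glued count, and they agree when `u` is unattached replaced by `v`
  have hle_u : ∀ ω : BondConfig (Fin n), (A.filter fun a => ω ∈ openConn u a).card ≤
      (A.filter fun a => ω ∈ openConn u a ∨ ω ∈ openConn v a).card := fun ω =>
    Finset.card_le_card fun a ha => by
      rw [Finset.mem_filter] at ha ⊢; exact ⟨ha.1, Or.inl ha.2⟩
  have hle_v : ∀ ω : BondConfig (Fin n), (A.filter fun a => ω ∈ openConn v a).card ≤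
      (A.filter fun a => ω ∈ openConn u a ∨ ω ∈ openConn v a).card := fun ω =>
    Finset.card_le_card fun a ha => by
      rw [Finset.mem_filter] at ha ⊢; exact ⟨ha.1, Or.inr ha.2⟩
  have heq_v : ∀ ω : BondConfig (Fin n), (∀ a ∈ A, ω ∉ openConn u a) →
      (A.filter fun a => ω ∈ openConn u a ∨ ω ∈ openConn v a).card =
        (A.filter fun a => ω ∈ openConn v a).card := fun ω hno => by
    congr 1
    exact Finset.filter_congr fun a ha => ⟨fun h => h.resolve_left (hno a ha), fun h => Or.inr h⟩
  -- (1) the light side is covered by the two pieces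
  have hXsub : X ⊆ (Dv ∩ Gp_u) ∪ (Zu ∩ Gp_v) := by
    intro ω hω
    simp only [hX, mem_setOf_eq] at hω
    obtain ⟨hcu, hcv, h1, h2, h3⟩ := hω
    by_cases hatt : ∃ a ∈ A, ω ∈ openConn u a
    · left
      refine ⟨hcv, ?_, (hle_u ω).trans h2, h3⟩
      obtain ⟨a, ha, hua⟩ := hatt
      exact Finset.card_pos.2 ⟨a, Finset.mem_filter.2 ⟨ha, hua⟩⟩
    · right
      push Not at hatt
      refine ⟨hatt, ?_⟩
      simp only [hGp_v, mem_setOf_eq]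
      rw [← heq_v ω hatt]
      exact ⟨h1, h2, h3⟩
  -- (2) the two heavy pieces lie in the heavy side, disjointly
  have hYsup : (Dv ∩ Gm_u) ∪ (Zu ∩ Gm_v) ⊆ Y := by
    rintro ω (⟨hcv, h1, h2⟩ | ⟨hzu, h1, h2⟩)
    · have hcu : ω ∉ openConn c u := fun hcu' => by
        have := card_eq_of_reachable A hcu'
        omega
      exact ⟨hcu, hcv, lt_of_lt_of_le h1 (hle_u ω), h2⟩
    · have hcu : ω ∉ openConn c u := fun hcu' => hzu c hcA (SimpleGraph.Reachable.symm hcu')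
      have hcv : ω ∉ openConn c v := fun hcv' => by
        have := card_eq_of_reachable A hcv'
        omega
      exact ⟨hcu, hcv, lt_of_lt_of_le h1 (hle_v ω), h2⟩
  have hdisj12 : Disjoint (Dv ∩ Gm_u) (Zu ∩ Gm_v) := by
    rw [Set.disjoint_left]
    rintro ω ⟨-, h1, -⟩ ⟨hzu, -⟩
    obtain ⟨a, ha, hua⟩ := exists_of_card_pos (lt_of_le_of_lt (Nat.zero_le j) h1)
    exact hzu a ha hua
  -- (3) measures
  have hXle : μ.real X ≤ μ.real (Dv ∩ Gp_u) + μ.real (Zu ∩ Gp_v) :=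
    (measureReal_mono hXsub).trans (measureReal_union_le _ _)
  have hYge : μ.real (Dv ∩ Gm_u) + μ.real (Zu ∩ Gm_v) ≤ μ.real Y := by
    rw [← measureReal_union hdisj12 MeasurableSet.of_discrete]
    exact measureReal_mono hYsup
  have e1 : μ.real Dv * (μ.real Gm_u - μ.real Gp_u) = μ.real Dv * μ.real Gm_u - μ.real Dv * μ.real Gp_u := by
    ring
  have e2 : μ.real Zu * (μ.real Gm_v - μ.real Gp_v) = μ.real Zu * μ.real Gm_v - μ.real Zu * μ.real Gp_v := by
    ring
  rw [e1, e2]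
  linarith [hXle, hYge, r1, r2, r3, r4]

/-- **T-form gluing across a separating witness** (the witness-separated case of the master gluing rule).  If the
relay `c ∈ A` separates `u ∈ V i` from `v ∈ V i'` (the vertices other than `c` covered by pairwise
non-adjacent sides `V l`) and the T-forms
`μ{1 ≤ N_u ≤ j} ≤ μ{1 ≤ N_u ∧ N_c ≤ j}`, `μ{1 ≤ N_v ≤ j} ≤ μ{1 ≤ N_v ∧ N_c ≤ j}` hold, then the glued pair satisfies
the T-form with the glued lightness of `c` (`= N_U` if `c ∈ U = C(u) ∪ C(v)`, else `N_c`):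
`μ{1 ≤ N_U ≤ j} ≤ μ{1 ≤ N_U ∧ N'_c ≤ j}`. [cite: Nolin2008, §4.3 Lemma 13 — via `glued_diff_ge`] -/
theorem tform_glued_of_tform (hcA : c ∈ A) (hcV : ∀ l, c ∉ V l)
    (hdisj : ∀ l l', l ≠ l' → Disjoint (V l) (V l'))
    (hcover : ∀ x, x ≠ c → ∃ l, x ∈ V l)
    (hsep : ∀ l l', l ≠ l' → ∀ x ∈ V l, ∀ y ∈ V l', w s(x, y) = 0)
    (i i' : Fin d) (hii' : i ≠ i') (hu : u ∈ V i) (hv : v ∈ V i')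
    (hTu : (prodBernoulli w).real {ω : BondConfig (Fin n) |
        1 ≤ (A.filter fun a => ω ∈ openConn u a).card ∧ (A.filter fun a => ω ∈ openConn u a).card ≤ j} ≤
      (prodBernoulli w).real {ω : BondConfig (Fin n) |
        1 ≤ (A.filter fun a => ω ∈ openConn u a).card ∧ (A.filter fun a => ω ∈ openConn c a).card ≤ j})
    (hTv : (prodBernoulli w).real {ω : BondConfig (Fin n) |
        1 ≤ (A.filter fun a => ω ∈ openConn v a).card ∧ (A.filter fun a => ω ∈ openConn v a).card ≤ j} ≤
      (prodBernoulli w).real {ω : BondConfig (Fin n) |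
        1 ≤ (A.filter fun a => ω ∈ openConn v a).card ∧ (A.filter fun a => ω ∈ openConn c a).card ≤ j}) :
    (prodBernoulli w).real {ω : BondConfig (Fin n) |
        1 ≤ (A.filter fun a => ω ∈ openConn u a ∨ ω ∈ openConn v a).card ∧
          (A.filter fun a => ω ∈ openConn u a ∨ ω ∈ openConn v a).card ≤ j} ≤
      (prodBernoulli w).real {ω : BondConfig (Fin n) |
        1 ≤ (A.filter fun a => ω ∈ openConn u a ∨ ω ∈ openConn v a).card ∧
          (if ω ∈ openConn c u ∨ ω ∈ openConn c v
            then (A.filter fun a => ω ∈ openConn u a ∨ ω ∈ openConn v a).card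
            else (A.filter fun a => ω ∈ openConn c a).card) ≤ j} := by
  set μ := prodBernoulli w with hμ
  haveI : IsProbabilityMeasure μ := by rw [hμ]; infer_instance
  -- slacks of the two T-forms
  have hsu : (prodBernoulli w).real {ω : BondConfig (Fin n) |
        1 ≤ (A.filter fun a => ω ∈ openConn u a).card ∧ (A.filter fun a => ω ∈ openConn u a).card ≤ j ∧
          j < (A.filter fun a => ω ∈ openConn c a).card} ≤
      (prodBernoulli w).real {ω : BondConfig (Fin n) |
        j < (A.filter fun a => ω ∈ openConn u a).card ∧ (A.filter fun a => ω ∈ openConn c a).card ≤ j} :=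
    slack_of_tform w (fun ω => (A.filter fun a => ω ∈ openConn u a).card)
      (fun ω => (A.filter fun a => ω ∈ openConn c a).card) j hTu
  have hsv : (prodBernoulli w).real {ω : BondConfig (Fin n) |
        1 ≤ (A.filter fun a => ω ∈ openConn v a).card ∧ (A.filter fun a => ω ∈ openConn v a).card ≤ j ∧
          j < (A.filter fun a => ω ∈ openConn c a).card} ≤
      (prodBernoulli w).real {ω : BondConfig (Fin n) |
        j < (A.filter fun a => ω ∈ openConn v a).card ∧ (A.filter fun a => ω ∈ openConn c a).card ≤ j} :=
    slack_of_tform w (fun ω => (A.filter fun a => ω ∈ openConn v a).card)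
      (fun ω => (A.filter fun a => ω ∈ openConn c a).card) j hTv
  have hglue := glued_diff_ge w A j c u v V hcA hcV hdisj hcover hsep i i' hii' hu hv
  -- the slack form of the conclusion
  refine tform_of_slack w (fun ω => (A.filter fun a => ω ∈ openConn u a ∨ ω ∈ openConn v a).card)
    (fun ω => if ω ∈ openConn c u ∨ ω ∈ openConn c v
      then (A.filter fun a => ω ∈ openConn u a ∨ ω ∈ openConn v a).card
      else (A.filter fun a => ω ∈ openConn c a).card) j ?_
  have eX : {ω : BondConfig (Fin n) |
      1 ≤ (A.filter fun a => ω ∈ openConn u a ∨ ω ∈ openConn v a).card ∧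
        (A.filter fun a => ω ∈ openConn u a ∨ ω ∈ openConn v a).card ≤ j ∧
        j < (if ω ∈ openConn c u ∨ ω ∈ openConn c v
          then (A.filter fun a => ω ∈ openConn u a ∨ ω ∈ openConn v a).card
          else (A.filter fun a => ω ∈ openConn c a).card)} =
      {ω : BondConfig (Fin n) | ω ∉ openConn c u ∧ ω ∉ openConn c v ∧
          1 ≤ (A.filter fun a => ω ∈ openConn u a ∨ ω ∈ openConn v a).card ∧
          (A.filter fun a => ω ∈ openConn u a ∨ ω ∈ openConn v a).card ≤ j ∧
          j < (A.filter fun a => ω ∈ openConn c a).card} := by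
    ext ω
    simp only [mem_setOf_eq]
    by_cases hU : ω ∈ openConn c u ∨ ω ∈ openConn c v
    · rw [if_pos hU]
      constructor
      · rintro ⟨-, h2, h3⟩; omega
      · rintro ⟨h1, h2, -⟩; exact absurd hU (not_or.2 ⟨h1, h2⟩)
    · rw [if_neg hU]
      rw [not_or] at hU
      tauto
  have eY : {ω : BondConfig (Fin n) |
      j < (A.filter fun a => ω ∈ openConn u a ∨ ω ∈ openConn v a).card ∧
        (if ω ∈ openConn c u ∨ ω ∈ openConn c v
          then (A.filter fun a => ω ∈ openConn u a ∨ ω ∈ openConn v a).card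
          else (A.filter fun a => ω ∈ openConn c a).card) ≤ j} =
      {ω : BondConfig (Fin n) | ω ∉ openConn c u ∧ ω ∉ openConn c v ∧
          j < (A.filter fun a => ω ∈ openConn u a ∨ ω ∈ openConn v a).card ∧
          (A.filter fun a => ω ∈ openConn c a).card ≤ j} := by
    ext ω
    simp only [mem_setOf_eq]
    by_cases hU : ω ∈ openConn c u ∨ ω ∈ openConn c v
    · rw [if_pos hU]
      constructor
      · rintro ⟨h2, h3⟩; omega
      · rintro ⟨h1, h2, -⟩; exact absurd hU (not_or.2 ⟨h1, h2⟩)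
    · rw [if_neg hU]
      rw [not_or] at hU
      tauto
  rw [eX, eY]
  have hnn1 : 0 ≤ μ.real {ω : BondConfig (Fin n) | ω ∉ openConn c v} := measureReal_nonneg
  have hnn2 : 0 ≤ μ.real {ω : BondConfig (Fin n) | ∀ a ∈ A, ω ∉ openConn u a} := measureReal_nonneg
  nlinarith [hglue, hsu, hsv, hnn1, hnn2]

end Glue

end WitnessSeparated

end Summit.CriticalPhenomena.PercolationContinuityZ3.Theorems

end
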